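import Summits.QuantumFields.BalabanUV.T4Continuum.Spine.NE3.PairLeftChartB8
import Literature.MathematicalPhysics.QuantumFieldTheory.Balaban1983to89.B8Eq138LandauZd
import Literature.MathematicalPhysics.QuantumFieldTheory.Balaban1983to89.B8Thm4TorusAt
import Summits.QuantumFields.BalabanUV.T4Continuum.Spine.NE3.LeafIndexSockets
import HarnessLib

/-!
# Route «BalabanUVNodes» (K4 «SpineRates»), DAG node N16 = NE3 — THE LAST TWO MEMBER DICTIONARIES OF THE N05 → N16 EDGE (THE END's END-framed Hölder
# and rough-Laplacian members of `Z = Ad_{W⁻¹}(iηA)` VERSUS print's (1.36)₃ ∕ (1.39)₁ letters) AND (OUT_print) ⟹ (OUT₁₃₈)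

Cell `pub-ymgap`, seat `pub-ymgap-dag-n16-a` (KNIT-BY-NAME, D-0062; chair R424 venue), generation 4, file 11; `--supports stmt-QuantumFields-19182`; `bears_on:
R4∕N16 · edge N05 → N16`.  Companion of n16-b's `Spine/NE3/PairLeftChartB8` (`rep∕skew∕sup∕grad`; its `covDiff_AdInv_eq`, `norm_Ad_sub_self_le`,
`Ad_iEta_sub_eq_covDerivFwd` are used BY NAME) and `PairLandau138B8` (`landau`); closes the member census of (OUT) (files 7∕9; dag-lead DEDUP-38 CLEAN).
§1 LAPLACIAN: `covLapDir_AdInv_eq` (THE END's `PairLandauB8.covLapDir` of `Ad_{W⁻¹}Y` = `Ad_{W(x,κ)⁻¹}` of print's second-difference stencils plus ONE plaquette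
insertion at `x` and ONE at `x − e_μ` per direction), `sum_secondDiff_eq_covLap` (the stencils sum to `−η²·Δ^η_W`, `Δ^η_W = B8Eq138LandauZd.covLap η W` =
[Balaban1985RegularSpaces] (1.39)'s `D^{η*}_{U₀}D^η_{U₀}` component-wise, [Balaban1985BackgroundPropagators] (3.23)), `norm_covLapDir_AdInv_le`.  §2 HÖLDER:
`holderDiff_AdInv_eq`, `norm_holderDiff_AdInv_le` (main term `η²`× the transported nearest-neighbour difference along `μ` of `D^η_{W,μ}A_κ = B8Ineq132.covDerivFwd`,
THE END's reading (R-f) of (1.36)₃; three plaquette errors).  §3 `thm4OutputLandau138_of_thm4OutputPrint` (any `d`): (OUT_print) = file 9's (OUT₁₃₈) with the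
Hölder ∕ Laplacian conjuncts in print's letters (`hol`, `ℓ`) IMPLIES (OUT₁₃₈) at `(S, g′, S₂, β ≤ 1, S₃)` on three k-free letter lines — after it every conjunct of
N16's N05-side edge binder is in print's ∕ node N05's letters (`mgauge`, `cfgExp`, `covDerivFwd`, `covLap`, `IsLandau138`, `Restr129`).
HONEST FRAMING: kinematics + bookkeeping, 0 def; [Balaban1985RegularSpaces] Thm 4 ∕ Prop 3 at curved backgrounds (node N05) NOT proved; N16 ∕ NE3 NOT
discharged; count-neutral; finite T⁴ at fixed ε — NOT ℝ⁴, NOT infinite volume, NOT OS, NOT a mass gap, NOT Clay.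
-/

set_option autoImplicit false

open scoped BigOperators Matrix Matrix.Norms.L2Operator
open NormedSpace

namespace Summit.QuantumFields.YangMills.BalabanUVNodes.N16

open Literature.MathematicalPhysics.QuantumFieldTheory.Balaban1983to89
open B7Prop1Explicit B7Prop2Explicit
open T4AveragingDeficitWall (IsUnitaryCfg SmallField Ad)
open T4AveragingDeficitNonAbelian (Ad_mul Ad_sub)
open B8Ineq132 (covDeriv covDerivFwd)
open B8Eq146AExpansion (iEta)
open B8Eq138LandauZd (covDivB covLap IsLandau138)
open B8Lemma1NonAbelian (pert)
open B7Eq92Concrete (mgauge)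
open B8Eq184Proof (cfgExp)
open B8Eq119TwistedAxial (Restr129)
open B8Eq166ConstraintPair (ptw)
open B8Thm4TorusAt (torusLam)
open Summit.QuantumFields.BalabanUV.T4Continuum
open AveragingDeficitTransport (norm_Ad_of_unitary mem_U1_of_unitary)
open AveragingDeficitNearIdentity (Ad_add Ad_one Ad_smul Ad_real_smul Ad_sum Ad_neg)
open MinimalActionClassSix (conjR_eq_Ad)
open MinimalActionSandwich (IsMinimiser)
open MinimalActionRate (Regular sfClass rescale_bavg_mem_sfClass)
open MinimalActionRefine (RegularSup)
open NE3.LeafIndexSockets (LeafH3sup)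
open NE3EnergyShapes (IsPeriodicSite)
open NE3.PairLandauB8 (covDiff covLapDir)
open NE3.PairLeftChartB8 (covDiff_AdInv_eq norm_Ad_sub_self_le norm_iEta Ad_iEta_sub_eq_covDerivFwd norm_Ad_iEta_sub)

noncomputable section

variable {d : ℕ} {n : Type*} [Fintype n] [DecidableEq n]

/-! ## §0 Plaquette letters -/

/-- The plaquette word at `x` in the `(κ, μ)`-plane, written out: `W(∂p_{κμ}(x)) = W(x,κ)·W(x+e_κ,μ)·W(x+e_μ,κ)⁻¹·W(x,μ)⁻¹`. [folklore] -/
theorem hol_plaqWord_eq (W : Site d → Fin d → (Matrix n n ℂ)ˣ) (x : Site d) (κ μ : Fin d) :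
    hol W x (plaqWord κ μ) = W x κ * W (x + e κ) μ * (W (x + e μ) κ)⁻¹ * (W x μ)⁻¹ := by
  rw [← lplaqWord_true, hol_lplaqWord]
  simp only [stepHol_true, Letter.vec_true]

/-- Every plaquette of a configuration in the small-field class `SmallField W a` (`a ≥ 0`) is within `a` of `1`, the degenerate `κ = μ` included
(there the word is trivial). [folklore] -/
theorem norm_plaq_sub_one_le {W : Site d → Fin d → (Matrix n n ℂ)ˣ} {a : ℝ} (ha : 0 ≤ a) (hWa : SmallField W a) (x : Site d) (κ μ : Fin d) :
    ‖((hol W x (plaqWord κ μ) : (Matrix n n ℂ)ˣ) : Matrix n n ℂ) - 1‖ ≤ a := by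
  by_cases hκμ : κ = μ
  · subst hκμ
    have h1 : hol W x (plaqWord κ κ) = 1 := by rw [hol_plaqWord_eq]; group
    rw [h1, Units.val_one, sub_self, norm_zero]
    exact ha
  · exact hWa x κ μ hκμ

/-- `‖(Ad_P − 1)T‖ ≤ 2a‖T‖` and `‖(Ad_{P⁻¹} − 1)T‖ ≤ 2a‖T‖` for a plaquette `P` of a unitary small-field configuration. [folklore] -/
theorem norm_Ad_plaq_sub_le [Nonempty n] {W : Site d → Fin d → (Matrix n n ℂ)ˣ} (hW : IsUnitaryCfg W) {a : ℝ} (ha : 0 ≤ a)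
    (hWa : SmallField W a) (x : Site d) (κ μ : Fin d) (T : Matrix n n ℂ) :
    ‖Ad (hol W x (plaqWord κ μ)) T - T‖ ≤ 2 * a * ‖T‖ ∧ ‖Ad (hol W x (plaqWord κ μ))⁻¹ T - T‖ ≤ 2 * a * ‖T‖ := by
  letI : CStarAlgebra (Matrix n n ℂ) := {}
  have hU1 : ∀ x κ, W x κ ∈ U1 (Matrix n n ℂ) := fun x κ => mem_U1_of_unitary (hW x κ)
  have hPm : hol W x (plaqWord κ μ) ∈ U1 (Matrix n n ℂ) := hol_mem hU1 _ _
  have hPa := norm_plaq_sub_one_le ha hWa x κ μ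
  refine ⟨(norm_Ad_sub_self_le hPm T).trans (by gcongr), (norm_Ad_sub_self_le ((U1 _).inv_mem hPm) T).trans ?_⟩
  have h := norm_inv_sub_one_le hPm
  have hT := norm_nonneg T
  nlinarith

/-! ## §1 The Laplacian dictionary: THE END's rough covariant Laplacian of `Z = Ad_{W⁻¹}Y` versus print's `D^{η*}_{U₀}D^η_{U₀}` -/

/-- **THE ROUGH LAPLACIAN OF `Z = Ad_{W⁻¹}Y`, EXACTLY**: with `P_y := W(∂p_{κμ}(y))`,
`covLapDir W Z x κ = Ad_{W(x,κ)⁻¹} Σ_μ { [Ad_{P_x}(Ad_{W(x,μ)}Y(x+e_μ,κ)) − Y(x,κ)] − [Y(x,κ) − Ad_{W(x−e_μ,μ)⁻¹}(Ad_{P_{x−e_μ}⁻¹} Y(x−e_μ,κ))] }` —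
THE END transports along the bonds through `x + e_κ`, the left chart along those through `x`; the two routes differ by one plaquette at `x` and one
at `x − e_μ`. [folklore] -/
theorem covLapDir_AdInv_eq (W : Site d → Fin d → (Matrix n n ℂ)ˣ) (Y : Site d → Fin d → Matrix n n ℂ) (x : Site d) (κ : Fin d) :
    covLapDir W (fun x μ => Ad (W x μ)⁻¹ (Y x μ)) x κ =
      Ad (W x κ)⁻¹ (∑ μ : Fin d,
        ((Ad (hol W x (plaqWord κ μ)) (Ad (W x μ) (Y (x + e μ) κ)) - Y x κ) -
          (Y x κ - Ad (W (x - e μ) μ)⁻¹ (Ad (hol W (x - e μ) (plaqWord κ μ))⁻¹ (Y (x - e μ) κ))))) := by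
  unfold covLapDir
  rw [Ad_sum]
  refine Finset.sum_congr rfl fun μ _ => ?_
  have hx : x - e μ + e μ = x := sub_add_cancel x (e μ)
  have hxx : x + e κ - e μ = x - e μ + e κ := by abel
  have hP := hol_plaqWord_eq W (x - e μ) κ μ
  rw [hx] at hP
  have key : (W (x - e μ + e κ) μ)⁻¹ * (W (x - e μ) κ)⁻¹ = (W x κ)⁻¹ * (W (x - e μ) μ)⁻¹ * (hol W (x - e μ) (plaqWord κ μ))⁻¹ := by
    rw [hP]; group
  have hS2 : Ad (W (x + e κ - e μ) μ)⁻¹ (covDiff W μ (fun x μ => Ad (W x μ)⁻¹ (Y x μ)) (x - e μ) κ) =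
      Ad (W x κ)⁻¹ (Y x κ - Ad (W (x - e μ) μ)⁻¹ (Ad (hol W (x - e μ) (plaqWord κ μ))⁻¹ (Y (x - e μ) κ))) := by
    rw [covDiff_AdInv_eq, hx, hxx, ← Ad_mul, key, Ad_mul, Ad_mul]
    congr 1
    rw [Ad_sub (hol W (x - e μ) (plaqWord κ μ))⁻¹, ← Ad_mul (hol W (x - e μ) (plaqWord κ μ))⁻¹ (hol W (x - e μ) (plaqWord κ μ)),
      inv_mul_cancel, Ad_one, Ad_sub (W (x - e μ) μ)⁻¹, ← Ad_mul (W (x - e μ) μ)⁻¹ (W (x - e μ) μ), inv_mul_cancel, Ad_one]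
  rw [hS2, covDiff_AdInv_eq, ← Ad_sub]

/-- **PRINT's STENCIL**: `[Ad_{W(x,μ)}f(x+e_μ) − f(x)] − [f(x) − Ad_{W(x−e_μ,μ)⁻¹}f(x−e_μ)] = −η²·(D^{η*}_{W,μ}D^η_{W,μ}f)(x)` for the (1.1) derivatives
`B8Ineq132.covDerivFwd ∕ covDeriv` (`η ≠ 0`). [folklore] -/
theorem secondDiff_eq_covDeriv {η : ℝ} (hη : η ≠ 0) (W : Site d → Fin d → (Matrix n n ℂ)ˣ) (f : Site d → Matrix n n ℂ) (μ : Fin d)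
    (x : Site d) :
    (Ad (W x μ) (f (x + e μ)) - f x) - (f x - Ad (W (x - e μ) μ)⁻¹ (f (x - e μ))) =
      -(η ^ 2) • covDeriv η W μ (fun z => covDerivFwd η W μ f z) x := by
  simp only [covDeriv, covDerivFwd, conjR_eq_Ad, sub_add_cancel, Ad_real_smul, Ad_sub, smul_sub, smul_smul]
  rw [← Ad_mul, inv_mul_cancel, Ad_one]
  have h1 : -η ^ 2 * (η⁻¹ * η⁻¹) = -1 := by field_simp
  simp only [h1, neg_one_smul]
  abel

/-- `Σ_μ` of print's stencils is `−η²·Δ^η_W f (x)` (`B8Eq138LandauZd.covLap`). [folklore] -/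
theorem sum_secondDiff_eq_covLap {η : ℝ} (hη : η ≠ 0) (W : Site d → Fin d → (Matrix n n ℂ)ˣ) (f : Site d → Matrix n n ℂ) (x : Site d) :
    ∑ μ : Fin d, ((Ad (W x μ) (f (x + e μ)) - f x) - (f x - Ad (W (x - e μ) μ)⁻¹ (f (x - e μ)))) = -(η ^ 2) • covLap η W f x := by
  unfold covLap covDivB
  rw [Finset.smul_sum]
  exact Finset.sum_congr rfl fun μ _ => secondDiff_eq_covDeriv hη W f μ x

/-- `Δ^η_W` is `ℂ`-linear in the field: `covLap η W (c • f) x = c • covLap η W f x`. [folklore] -/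
theorem covLap_smul (η : ℝ) (W : Site d → Fin d → (Matrix n n ℂ)ˣ) (c : ℂ) (f : Site d → Matrix n n ℂ) (x : Site d) :
    covLap η W (c • f) x = c • covLap η W f x := by
  unfold covLap covDivB
  rw [Finset.smul_sum]
  refine Finset.sum_congr rfl fun μ _ => ?_
  have h : (fun z => covDerivFwd η W μ (c • f) z) = c • fun z => covDerivFwd η W μ f z := by
    funext z
    simp only [covDerivFwd, Pi.smul_apply, conjR_eq_Ad, Ad_smul, ← smul_sub]
    exact smul_comm _ _ _
  rw [h, B8Eq146AExpansion.covDeriv_smul]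


/-- `‖(iη)•A(b)‖ = η‖A(b)‖ ≤ η·s` at any bond, for `η ≥ 0` and `‖A‖ ≤ s`. [folklore] -/
theorem norm_iEta_le {η : ℝ} (hη : 0 ≤ η) {A : Site d → Fin d → Matrix n n ℂ} {s : ℝ} (hs : ∀ x μ, ‖A x μ‖ ≤ s) (x : Site d) (μ : Fin d) :
    ‖iEta η A x μ‖ ≤ η * s := by
  rw [norm_iEta hη]; exact mul_le_mul_of_nonneg_left (hs x μ) hη

/-- **THE LAPLACIAN DICTIONARY**: for unitary `W` in the small-field class `SmallField W a` (`a ≥ 0`), `η > 0`, and `Z = Ad_{W⁻¹}(iEta η A)`: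
`‖covLapDir W Z x κ‖ ≤ η³·‖Δ^η_W A_κ (x)‖ + 2a·Σ_μ (‖(iηA)(x+e_μ,κ)‖ + ‖(iηA)(x−e_μ,κ)‖)`, `Δ^η_W A_κ = covLap η W (A · κ)` = print's component-wise
`D^{η*}_{U₀}D^η_{U₀}A` of [Balaban1985RegularSpaces] (1.39) (`B8Eq138LandauZd.covLap`, [Balaban1985BackgroundPropagators] (3.23)). [folklore] -/
theorem norm_covLapDir_AdInv_le [Nonempty n] {W : Site d → Fin d → (Matrix n n ℂ)ˣ} (hW : IsUnitaryCfg W) {a : ℝ} (ha : 0 ≤ a)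
    (hWa : SmallField W a) {η : ℝ} (hη : 0 < η) (A : Site d → Fin d → Matrix n n ℂ) (x : Site d) (κ : Fin d) :
    ‖covLapDir W (fun x μ => Ad (W x μ)⁻¹ (iEta η A x μ)) x κ‖ ≤
      η ^ 3 * ‖covLap η W (fun z => A z κ) x‖ + 2 * a * ∑ μ : Fin d, (‖iEta η A (x + e μ) κ‖ + ‖iEta η A (x - e μ) κ‖) := by
  rw [covLapDir_AdInv_eq, norm_Ad_of_unitary ((unitaryUnits _).inv_mem (hW x κ))]
  -- each summand = print's stencil + two plaquette errors
  have hsplit : ∀ μ : Fin d,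
      (Ad (hol W x (plaqWord κ μ)) (Ad (W x μ) (iEta η A (x + e μ) κ)) - iEta η A x κ) -
          (iEta η A x κ - Ad (W (x - e μ) μ)⁻¹ (Ad (hol W (x - e μ) (plaqWord κ μ))⁻¹ (iEta η A (x - e μ) κ))) =
        ((Ad (W x μ) (iEta η A (x + e μ) κ) - iEta η A x κ) - (iEta η A x κ - Ad (W (x - e μ) μ)⁻¹ (iEta η A (x - e μ) κ))) +
          ((Ad (hol W x (plaqWord κ μ)) (Ad (W x μ) (iEta η A (x + e μ) κ)) - Ad (W x μ) (iEta η A (x + e μ) κ)) +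
            Ad (W (x - e μ) μ)⁻¹ (Ad (hol W (x - e μ) (plaqWord κ μ))⁻¹ (iEta η A (x - e μ) κ) - iEta η A (x - e μ) κ)) := by
    intro μ; rw [Ad_sub (W (x - e μ) μ)⁻¹]; abel
  have hsum := sum_secondDiff_eq_covLap hη.ne' W (fun z => iEta η A z κ) x
  rw [Finset.sum_congr rfl fun μ _ => hsplit μ, Finset.sum_add_distrib, hsum]
  have hmain : ‖-(η ^ 2) • covLap η W (fun z => iEta η A z κ) x‖ = η ^ 3 * ‖covLap η W (fun z => A z κ) x‖ := by
    have hY : (fun z => iEta η A z κ) = ((Complex.I : ℂ) * η) • fun z => A z κ := rfl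
    rw [hY, covLap_smul, norm_smul, norm_smul, norm_neg, norm_mul, Complex.norm_I, one_mul, Complex.norm_real, Real.norm_eq_abs,
      Real.norm_eq_abs, abs_of_pos hη, abs_of_pos (by positivity : (0 : ℝ) < η ^ 2)]
    ring
  have herr : ∀ μ : Fin d,
      ‖(Ad (hol W x (plaqWord κ μ)) (Ad (W x μ) (iEta η A (x + e μ) κ)) - Ad (W x μ) (iEta η A (x + e μ) κ)) +
          Ad (W (x - e μ) μ)⁻¹ (Ad (hol W (x - e μ) (plaqWord κ μ))⁻¹ (iEta η A (x - e μ) κ) - iEta η A (x - e μ) κ)‖ ≤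
        2 * a * (‖iEta η A (x + e μ) κ‖ + ‖iEta η A (x - e μ) κ‖) := by
    intro μ
    have h1 := (norm_Ad_plaq_sub_le hW ha hWa x κ μ (Ad (W x μ) (iEta η A (x + e μ) κ))).1
    rw [norm_Ad_of_unitary (hW x μ)] at h1
    have h2 := (norm_Ad_plaq_sub_le hW ha hWa (x - e μ) κ μ (iEta η A (x - e μ) κ)).2
    rw [← norm_Ad_of_unitary ((unitaryUnits _).inv_mem (hW (x - e μ) μ))] at h2
    calc _ ≤ _ + _ := norm_add_le _ _
      _ ≤ 2 * a * ‖iEta η A (x + e μ) κ‖ + 2 * a * ‖iEta η A (x - e μ) κ‖ := add_le_add h1 h2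
      _ = _ := by ring
  calc _ ≤ ‖-(η ^ 2) • covLap η W (fun z => iEta η A z κ) x‖ + ‖∑ μ : Fin d,
          ((Ad (hol W x (plaqWord κ μ)) (Ad (W x μ) (iEta η A (x + e μ) κ)) - Ad (W x μ) (iEta η A (x + e μ) κ)) +
            Ad (W (x - e μ) μ)⁻¹ (Ad (hol W (x - e μ) (plaqWord κ μ))⁻¹ (iEta η A (x - e μ) κ) - iEta η A (x - e μ) κ))‖ :=
        norm_add_le _ _
    _ ≤ η ^ 3 * ‖covLap η W (fun z => A z κ) x‖ + ∑ μ : Fin d, 2 * a * (‖iEta η A (x + e μ) κ‖ + ‖iEta η A (x - e μ) κ‖) := by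
        rw [hmain]
        exact add_le_add le_rfl ((norm_sum_le _ _).trans (Finset.sum_le_sum fun μ _ => herr μ))
    _ = _ := by rw [Finset.mul_sum]

/-! ## §2 The Hölder dictionary: THE END's second covariant difference of `Z = Ad_{W⁻¹}Y` along `μ` versus print's nearest-neighbour (1.36)₃ -/

/-- **THE SECOND COVARIANT DIFFERENCE OF `Z = Ad_{W⁻¹}Y` ALONG `μ`, EXACTLY**: with `P_y := W(∂p_{κμ}(y))`,
`Ad_{W(y+e_κ,μ)}(∇_μZ)(y+e_μ,κ) − (∇_μZ)(y,κ) = Ad_{W(y,κ)⁻¹}{ Ad_{P_y}Ad_{W(y,μ)}[Ad_{P_{y+e_μ}}Ad_{W(y+e_μ,μ)}Y(y+2e_μ,κ) − Y(y+e_μ,κ)] −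
[Ad_{P_y}Ad_{W(y,μ)}Y(y+e_μ,κ) − Y(y,κ)] }` (`∇_μ = PairLandauB8.covDiff W μ`). [folklore] -/
theorem holderDiff_AdInv_eq (W : Site d → Fin d → (Matrix n n ℂ)ˣ) (Y : Site d → Fin d → Matrix n n ℂ) (μ : Fin d) (y : Site d) (κ : Fin d) :
    Ad (W (y + e κ) μ) (covDiff W μ (fun x μ => Ad (W x μ)⁻¹ (Y x μ)) (y + e μ) κ) - covDiff W μ (fun x μ => Ad (W x μ)⁻¹ (Y x μ)) y κ =
      Ad (W y κ)⁻¹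
        (Ad (hol W y (plaqWord κ μ)) (Ad (W y μ)
            (Ad (hol W (y + e μ) (plaqWord κ μ)) (Ad (W (y + e μ) μ) (Y (y + e μ + e μ) κ)) - Y (y + e μ) κ)) -
          (Ad (hol W y (plaqWord κ μ)) (Ad (W y μ) (Y (y + e μ) κ)) - Y y κ)) := by
  rw [covDiff_AdInv_eq, covDiff_AdInv_eq, ← Ad_mul (W (y + e κ) μ)]
  have key : W (y + e κ) μ * (W (y + e μ) κ)⁻¹ = (W y κ)⁻¹ * hol W y (plaqWord κ μ) * W y μ := by rw [hol_plaqWord_eq]; group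
  rw [key, Ad_mul, Ad_mul, ← Ad_sub]

/-- **THE HÖLDER DICTIONARY**: for unitary `W` in `SmallField W a` (`a ≥ 0`), `η > 0`, `Z = Ad_{W⁻¹}(iEta η A)`:
`‖Ad_{W(y+e_κ,μ)}(∇_μZ)(y+e_μ,κ) − (∇_μZ)(y,κ)‖ ≤ η²·‖Ad_{W(y,μ)}(D^η_{W,μ}A_κ)(y+e_μ) − (D^η_{W,μ}A_κ)(y)‖ + 4a(‖(iηA)(y+2e_μ,κ)‖ + ‖(iηA)(y+e_μ,κ)‖)`
— the main term is `η²` × the transported nearest-neighbour difference along `μ` of print's (1.1) derivative `D^η_{W,μ}A_κ = covDerivFwd η W μ (A · κ)`, i.e.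
THE END's reading (R-f) of [Balaban1985RegularSpaces] (1.36)₃ `‖A‖_{1,β}` at distance `η`. [folklore] -/
theorem norm_holderDiff_AdInv_le [Nonempty n] {W : Site d → Fin d → (Matrix n n ℂ)ˣ} (hW : IsUnitaryCfg W) {a : ℝ} (ha : 0 ≤ a)
    (hWa : SmallField W a) {η : ℝ} (hη : 0 < η) (A : Site d → Fin d → Matrix n n ℂ) (μ : Fin d) (y : Site d) (κ : Fin d) :
    ‖Ad (W (y + e κ) μ) (covDiff W μ (fun x μ => Ad (W x μ)⁻¹ (iEta η A x μ)) (y + e μ) κ) -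
        covDiff W μ (fun x μ => Ad (W x μ)⁻¹ (iEta η A x μ)) y κ‖ ≤
      η ^ 2 * ‖Ad (W y μ) (covDerivFwd η W μ (fun z => A z κ) (y + e μ)) - covDerivFwd η W μ (fun z => A z κ) y‖ +
        (4 * a * ‖iEta η A (y + e μ + e μ) κ‖ + 4 * a * ‖iEta η A (y + e μ) κ‖) := by
  rw [holderDiff_AdInv_eq, norm_Ad_of_unitary ((unitaryUnits _).inv_mem (hW y κ))]
  have hPu : hol W (y + e μ) (plaqWord κ μ) ∈ unitaryUnits (Matrix n n ℂ) := hol_mem_of hW _ _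
  -- inner = main + E₁ + E₂ − E₃
  have hsplit :
      Ad (hol W y (plaqWord κ μ)) (Ad (W y μ)
          (Ad (hol W (y + e μ) (plaqWord κ μ)) (Ad (W (y + e μ) μ) (iEta η A (y + e μ + e μ) κ)) - iEta η A (y + e μ) κ)) -
        (Ad (hol W y (plaqWord κ μ)) (Ad (W y μ) (iEta η A (y + e μ) κ)) - iEta η A y κ) =
      (Ad (W y μ) (Ad (W (y + e μ) μ) (iEta η A (y + e μ + e μ) κ) - iEta η A (y + e μ) κ) -
          (Ad (W y μ) (iEta η A (y + e μ) κ) - iEta η A y κ)) +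
        ((Ad (hol W y (plaqWord κ μ)) (Ad (W y μ)
              (Ad (hol W (y + e μ) (plaqWord κ μ)) (Ad (W (y + e μ) μ) (iEta η A (y + e μ + e μ) κ)) - iEta η A (y + e μ) κ)) -
            Ad (W y μ) (Ad (hol W (y + e μ) (plaqWord κ μ)) (Ad (W (y + e μ) μ) (iEta η A (y + e μ + e μ) κ)) - iEta η A (y + e μ) κ)) +
          Ad (W y μ) (Ad (hol W (y + e μ) (plaqWord κ μ)) (Ad (W (y + e μ) μ) (iEta η A (y + e μ + e μ) κ)) -
              Ad (W (y + e μ) μ) (iEta η A (y + e μ + e μ) κ)) -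
          (Ad (hol W y (plaqWord κ μ)) (Ad (W y μ) (iEta η A (y + e μ) κ)) - Ad (W y μ) (iEta η A (y + e μ) κ))) := by
    simp only [Ad_sub]; abel
  rw [hsplit]
  have hmain : Ad (W y μ) (Ad (W (y + e μ) μ) (iEta η A (y + e μ + e μ) κ) - iEta η A (y + e μ) κ) - (Ad (W y μ) (iEta η A (y + e μ) κ) - iEta η A y κ)
      = ((Complex.I : ℂ) * η * η) • (Ad (W y μ) (covDerivFwd η W μ (fun z => A z κ) (y + e μ)) - covDerivFwd η W μ (fun z => A z κ) y) := by
    rw [Ad_iEta_sub_eq_covDerivFwd hη.ne', Ad_iEta_sub_eq_covDerivFwd hη.ne', Ad_smul, smul_sub]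
  have hmain' : ‖Ad (W y μ) (Ad (W (y + e μ) μ) (iEta η A (y + e μ + e μ) κ) - iEta η A (y + e μ) κ) -
      (Ad (W y μ) (iEta η A (y + e μ) κ) - iEta η A y κ)‖ =
      η ^ 2 * ‖Ad (W y μ) (covDerivFwd η W μ (fun z => A z κ) (y + e μ)) - covDerivFwd η W μ (fun z => A z κ) y‖ := by
    rw [hmain, norm_smul, norm_mul, norm_mul, Complex.norm_I, one_mul, Complex.norm_real, Real.norm_eq_abs, abs_of_pos hη, sq]
  have hE1 := (norm_Ad_plaq_sub_le hW ha hWa y κ μ (Ad (W y μ)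
      (Ad (hol W (y + e μ) (plaqWord κ μ)) (Ad (W (y + e μ) μ) (iEta η A (y + e μ + e μ) κ)) - iEta η A (y + e μ) κ))).1
  have hT1 : ‖Ad (W y μ) (Ad (hol W (y + e μ) (plaqWord κ μ)) (Ad (W (y + e μ) μ) (iEta η A (y + e μ + e μ) κ)) - iEta η A (y + e μ) κ)‖ ≤
      ‖iEta η A (y + e μ + e μ) κ‖ + ‖iEta η A (y + e μ) κ‖ := by
    rw [norm_Ad_of_unitary (hW y μ)]
    refine (norm_sub_le _ _).trans ?_
    rw [norm_Ad_of_unitary hPu, norm_Ad_of_unitary (hW _ _)]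
  have hE2 := (norm_Ad_plaq_sub_le hW ha hWa (y + e μ) κ μ (Ad (W (y + e μ) μ) (iEta η A (y + e μ + e μ) κ))).1
  rw [norm_Ad_of_unitary (hW _ _), ← norm_Ad_of_unitary (hW y μ) (Ad _ _ - _)] at hE2
  have hE3 := (norm_Ad_plaq_sub_le hW ha hWa y κ μ (Ad (W y μ) (iEta η A (y + e μ) κ))).1
  rw [norm_Ad_of_unitary (hW y μ)] at hE3
  have hY2 := norm_nonneg (iEta η A (y + e μ + e μ) κ)
  have hY1 := norm_nonneg (iEta η A (y + e μ) κ)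
  calc _ ≤ _ + _ := norm_add_le _ _
    _ ≤ _ := by
        rw [hmain']
        refine add_le_add le_rfl ?_
        refine (norm_sub_le _ _).trans ?_
        refine (add_le_add (norm_add_le _ _) le_rfl).trans ?_
        nlinarith [hE1, hT1, hE2, hE3, mul_nonneg (mul_nonneg (by norm_num : (0:ℝ) ≤ 2) ha) hY1,
          mul_nonneg (mul_nonneg (by norm_num : (0:ℝ) ≤ 2) ha) hY2]


/-! ## §3 (OUT_print) ⟹ (OUT₁₃₈): every member of the N05 → N16 edge binder in print's ∕ node N05's letters -/

set_option maxHeartbeats 400000 in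
/-- **THEOREM 4's OUTPUT AT THE PAIR IN PRINT's LETTERS IMPLIES THE END's EDGE BINDER** (any `d`; `L ≥ 2`; class regularity letter `b ≥ 0` with
`512(d+1)(d+4)L²b ≤ 1`; Hölder exponent `β ≤ 1`).  The binder (OUT_print) — per level `k ≥ 1`, datum and minimiser pair, with `W = rescale L (bavg L U_B)`,
`η = (Lᵏ)⁻¹`: a unitary periodic `u` with (1.29) on `Λ_k = T^{(k)}`, a self-adjoint periodic `A` with `U₁ = U′^{u⁻¹} = e^{iηA}` (`mgauge`∕`cfgExp`∕`pert`),
[Balaban1985RegularSpaces] (1.36)₁ `‖A‖ ≤ s`, (1.36)₂ `‖D^η_{W,μ}A_κ‖ ≤ g′` (`covDerivFwd`), (1.38) `IsLandau138 L k η univ (torusLam k) W A`, (1.36)₃ at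
nearest-neighbour distance along `μ`: `‖Ad_{W(y,μ)}(D^η_{W,μ}A_κ)(y+e_μ) − D^η_{W,μ}A_κ(y)‖ ≤ hol·ξ^{kβ}`, (1.39)₁ `‖Δ^η_W A_κ‖ ≤ ℓ` (`covLap`) — IMPLIES
file 9's (OUT₁₃₈) at any letters `(S, g′, S₂, β, S₃)` with `s ≤ S`, `hol + 8α_{b′}s ≤ S₂`, `ℓ + 4dα_{b′}s ≤ S₃`, `α_{b′} = b′ + 226(8(d+1)(d+4))²b′²` the
(H3ˢᵘᵖ) radius of `U_B` (§1–§2 at the pair background: plaquettes of `W` within `α_{b′}η²` of 1 by `rescale_bavg_mem_sfClass`, `‖iηA‖ ≤ ηs`, `η³ ≤ η^{2+β}`). [folklore] -/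
theorem thm4OutputLandau138_of_thm4OutputPrint [Nonempty n] {L N : ℕ} (hL : 2 ≤ L) {ε b g b' c' s g' hol ℓ β S S₂ S₃ : ℝ}
    (hb' : 0 ≤ b') (hbs' : 512 * (d + 1) * (d + 4) * (L : ℝ) ^ 2 * b' ≤ 1) (hβ : β ≤ 1) (hS : s ≤ S)
    (hS₂ : hol + 8 * (b' + 226 * (8 * (d + 1) * (d + 4)) ^ 2 * b' ^ 2) * s ≤ S₂) (hS₃ : ℓ + 4 * d * (b' + 226 * (8 * (d + 1) * (d + 4)) ^ 2 * b' ^ 2) * s ≤ S₃)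
    {dom : Set (Site d → Fin d → (Matrix n n ℂ)ˣ)}
    (hOut :
      ∀ k : ℕ, 1 ≤ k → ∀ V ∈ dom, ∀ UA UB : Site d → Fin d → (Matrix n n ℂ)ˣ,
        IsMinimiser d (sfClass d L N ε) L N k V UA → IsMinimiser d (sfClass d L N ε) L N (k + 1) V UB → Regular d L N b g (k + 1) UB →
        ∃ u : Site d → (Matrix n n ℂ)ˣ, (∀ x, u x ∈ unitaryUnits (Matrix n n ℂ)) ∧ IsPeriodicSite u (((N * L ^ k : ℕ) : ℤ)) ∧
          (∃ Λ : ℕ → Set (Site d), Λ k = Set.univ ∧ Restr129 L k Λ (rescale L (bavg L UB)) u) ∧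
          ∃ A : Site d → Fin d → Matrix n n ℂ,
            (∀ x μ, IsSelfAdjoint (A x μ)) ∧ (∀ (x : Site d) (κ μ : Fin d), A (x + (((N * L ^ k : ℕ) : ℤ)) • e κ) μ = A x μ) ∧
            mgauge (rescale L (bavg L UB)) u (cfgExp (((L : ℝ) ^ k)⁻¹) A)
              = pert (gaugeAct (ptw L (rescale L (bavg L UB)) UA k) UA) (rescale L (bavg L UB)) ∧
            (∀ x μ, ‖A x μ‖ ≤ s) ∧
            (∀ (μ : Fin d) (x : Site d) (κ : Fin d), ‖covDerivFwd (((L : ℝ) ^ k)⁻¹) (rescale L (bavg L UB)) μ (fun z => A z κ) x‖ ≤ g') ∧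
            IsLandau138 L k (((L : ℝ) ^ k)⁻¹) Set.univ (torusLam k) (rescale L (bavg L UB)) A ∧
            (∀ (μ : Fin d) (y : Site d) (κ : Fin d),
              ‖Ad (rescale L (bavg L UB) y μ) (covDerivFwd (((L : ℝ) ^ k)⁻¹) (rescale L (bavg L UB)) μ (fun z => A z κ) (y + e μ)) - covDerivFwd (((L : ℝ) ^ k)⁻¹) (rescale L (bavg L UB)) μ (fun z => A z κ) y‖
                ≤ hol * (((L : ℝ)⁻¹) ^ k) ^ β) ∧
            (∀ (x : Site d) (κ : Fin d), ‖covLap (((L : ℝ) ^ k)⁻¹) (rescale L (bavg L UB)) (fun z => A z κ) x‖ ≤ ℓ))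
    (h3 : LeafH3sup d L N ε b' c' dom) :
    ∀ k : ℕ, 1 ≤ k → ∀ V ∈ dom, ∀ UA UB : Site d → Fin d → (Matrix n n ℂ)ˣ,
      IsMinimiser d (sfClass d L N ε) L N k V UA → IsMinimiser d (sfClass d L N ε) L N (k + 1) V UB → Regular d L N b g (k + 1) UB →
      ∃ u : Site d → (Matrix n n ℂ)ˣ, (∀ x, u x ∈ unitaryUnits (Matrix n n ℂ)) ∧ IsPeriodicSite u (((N * L ^ k : ℕ) : ℤ)) ∧
        (∃ Λ : ℕ → Set (Site d), Λ k = Set.univ ∧ Restr129 L k Λ (rescale L (bavg L UB)) u) ∧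
        ∃ A : Site d → Fin d → Matrix n n ℂ,
          (∀ x μ, IsSelfAdjoint (A x μ)) ∧ (∀ (x : Site d) (κ μ : Fin d), A (x + (((N * L ^ k : ℕ) : ℤ)) • e κ) μ = A x μ) ∧
          mgauge (rescale L (bavg L UB)) u (cfgExp (((L : ℝ) ^ k)⁻¹) A)
            = pert (gaugeAct (ptw L (rescale L (bavg L UB)) UA k) UA) (rescale L (bavg L UB)) ∧
          (∀ x μ, ‖A x μ‖ ≤ S) ∧
          (∀ (μ : Fin d) (x : Site d) (κ : Fin d), ‖covDerivFwd (((L : ℝ) ^ k)⁻¹) (rescale L (bavg L UB)) μ (fun z => A z κ) x‖ ≤ g') ∧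
          IsLandau138 L k (((L : ℝ) ^ k)⁻¹) Set.univ (torusLam k) (rescale L (bavg L UB)) A ∧
          (∀ (κ μ : Fin d) (y : Site d),
            ‖Ad (rescale L (bavg L UB) (y + e κ) μ)
                (Ad (rescale L (bavg L UB) (y + e κ + e μ) μ)
                    ((fun x μ => Ad (rescale L (bavg L UB) x μ)⁻¹ (iEta (((L : ℝ) ^ k)⁻¹) A x μ)) (y + (2 : ℕ) • e μ) κ)
                  - (fun x μ => Ad (rescale L (bavg L UB) x μ)⁻¹ (iEta (((L : ℝ) ^ k)⁻¹) A x μ)) (y + e μ) κ)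
              - (Ad (rescale L (bavg L UB) (y + e κ) μ) ((fun x μ => Ad (rescale L (bavg L UB) x μ)⁻¹ (iEta (((L : ℝ) ^ k)⁻¹) A x μ)) (y + e μ) κ)
                - (fun x μ => Ad (rescale L (bavg L UB) x μ)⁻¹ (iEta (((L : ℝ) ^ k)⁻¹) A x μ)) y κ)‖
              ≤ S₂ * (((L : ℝ)⁻¹) ^ k) ^ ((2 : ℝ) + β)) ∧
          (∀ (x : Site d) (κ : Fin d),
            ‖covLapDir (rescale L (bavg L UB)) (fun x μ => Ad (rescale L (bavg L UB) x μ)⁻¹ (iEta (((L : ℝ) ^ k)⁻¹) A x μ)) x κ‖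
              ≤ S₃ * (((L : ℝ)⁻¹) ^ k) ^ 3) := by
  intro k hk V hV UA UB hA hB hreg
  have hL1 : 1 ≤ L := le_trans (by norm_num) hL
  have hL1r : (1 : ℝ) ≤ L := by exact_mod_cast hL1
  have hLk : (1 : ℝ) ≤ (L : ℝ) ^ k := one_le_pow₀ hL1r
  obtain ⟨u, hu, huP, hres, A, hAsa, hAP, hmg, hs, hg, h138, hhol, hlap⟩ := hOut k hk V hV UA UB hA hB hreg
  -- the pair's background ((H3ˢᵘᵖ) at `U_B`): unitary, periodic, plaquettes within `a = α_{b′}·η²` of `1`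
  have hαb0 : 0 ≤ (b' + 226 * (8 * (d + 1) * (d + 4)) ^ 2 * b' ^ 2) := by positivity
  obtain ⟨hWu, -, hWsm⟩ := rescale_bavg_mem_sfClass hL1 hb' hbs' le_rfl (h3 V hV k UB hB).regular
  have ha : 0 ≤ (b' + 226 * (8 * (d + 1) * (d + 4)) ^ 2 * b' ^ 2) / ((L : ℝ) ^ k) ^ 2 := div_nonneg hαb0 (by positivity)
  have hη : (0 : ℝ) < ((L : ℝ) ^ k)⁻¹ := by positivity
  have hηk : ((L : ℝ) ^ k)⁻¹ = ((L : ℝ)⁻¹) ^ k := (inv_pow _ _).symm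
  have hη1 : ((L : ℝ) ^ k)⁻¹ ≤ 1 := inv_le_one_of_one_le₀ hLk
  have ha' : (b' + 226 * (8 * (d + 1) * (d + 4)) ^ 2 * b' ^ 2) / ((L : ℝ) ^ k) ^ 2 = (b' + 226 * (8 * (d + 1) * (d + 4)) ^ 2 * b' ^ 2) * (((L : ℝ) ^ k)⁻¹) ^ 2 := by
    rw [div_eq_mul_inv, inv_pow]
  refine ⟨u, hu, huP, hres, A, hAsa, hAP, hmg, fun x μ => (hs x μ).trans hS, hg, h138, fun κ μ y => ?_, fun x κ => ?_⟩
  · -- the Hölder member (§2)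
    have hs0 : 0 ≤ s := (norm_nonneg _).trans (hs y κ)
    have e1 : y + e κ + e μ = y + e μ + e κ := add_right_comm _ _ _
    have e2 : y + (2 : ℕ) • e μ = y + e μ + e μ := by rw [two_nsmul, add_assoc]
    rw [e1, e2]
    show ‖Ad (rescale L (bavg L UB) (y + e κ) μ) (covDiff (rescale L (bavg L UB)) μ (fun x μ => Ad (rescale L (bavg L UB) x μ)⁻¹ (iEta (((L : ℝ) ^ k)⁻¹) A x μ)) (y + e μ) κ) -
        covDiff (rescale L (bavg L UB)) μ (fun x μ => Ad (rescale L (bavg L UB) x μ)⁻¹ (iEta (((L : ℝ) ^ k)⁻¹) A x μ)) y κ‖ ≤ _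
    refine (norm_holderDiff_AdInv_le hWu ha hWsm hη A μ y κ).trans ?_
    have hY2 := norm_iEta_le hη.le hs (y + e μ + e μ) κ
    have hY1 := norm_iEta_le hη.le hs (y + e μ) κ
    have hH := hhol μ y κ
    rw [← hηk] at hH ⊢
    -- `η²·η^β = η^{2+β}` and `η³ ≤ η^{2+β}`
    have hpow : (((L : ℝ) ^ k)⁻¹) ^ 2 * (((L : ℝ) ^ k)⁻¹) ^ β = (((L : ℝ) ^ k)⁻¹) ^ ((2 : ℝ) + β) := by
      rw [Real.rpow_add hη, Real.rpow_two]
    have hpow3 : (((L : ℝ) ^ k)⁻¹) ^ 3 ≤ (((L : ℝ) ^ k)⁻¹) ^ ((2 : ℝ) + β) := by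
      have h := Real.rpow_le_rpow_of_exponent_ge hη hη1 (by linarith : (2 : ℝ) + β ≤ 3)
      rwa [show ((3 : ℝ)) = ((3 : ℕ) : ℝ) by norm_num, Real.rpow_natCast] at h
    have hηβ0 : 0 ≤ (((L : ℝ) ^ k)⁻¹) ^ β := Real.rpow_nonneg hη.le _
    have h2 : (((L : ℝ) ^ k)⁻¹) ^ 2 * ‖Ad (rescale L (bavg L UB) y μ) (covDerivFwd (((L : ℝ) ^ k)⁻¹) (rescale L (bavg L UB)) μ (fun z => A z κ) (y + e μ)) -
        covDerivFwd (((L : ℝ) ^ k)⁻¹) (rescale L (bavg L UB)) μ (fun z => A z κ) y‖ ≤ hol * (((L : ℝ) ^ k)⁻¹) ^ ((2 : ℝ) + β) := by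
      rw [← hpow, mul_comm hol, mul_assoc]
      exact mul_le_mul_of_nonneg_left (by rw [mul_comm]; exact hH) (by positivity)
    have h3 : 4 * ((b' + 226 * (8 * (d + 1) * (d + 4)) ^ 2 * b' ^ 2) / ((L : ℝ) ^ k) ^ 2) * ‖iEta (((L : ℝ) ^ k)⁻¹) A (y + e μ + e μ) κ‖ +
        4 * ((b' + 226 * (8 * (d + 1) * (d + 4)) ^ 2 * b' ^ 2) / ((L : ℝ) ^ k) ^ 2) * ‖iEta (((L : ℝ) ^ k)⁻¹) A (y + e μ) κ‖ ≤
        8 * (b' + 226 * (8 * (d + 1) * (d + 4)) ^ 2 * b' ^ 2) * s * (((L : ℝ) ^ k)⁻¹) ^ ((2 : ℝ) + β) := by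
      rw [ha']
      have h4 : 4 * ((b' + 226 * (8 * (d + 1) * (d + 4)) ^ 2 * b' ^ 2) * (((L : ℝ) ^ k)⁻¹) ^ 2) * ‖iEta (((L : ℝ) ^ k)⁻¹) A (y + e μ + e μ) κ‖ +
          4 * ((b' + 226 * (8 * (d + 1) * (d + 4)) ^ 2 * b' ^ 2) * (((L : ℝ) ^ k)⁻¹) ^ 2) * ‖iEta (((L : ℝ) ^ k)⁻¹) A (y + e μ) κ‖ ≤
          8 * (b' + 226 * (8 * (d + 1) * (d + 4)) ^ 2 * b' ^ 2) * s * (((L : ℝ) ^ k)⁻¹) ^ 3 := by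
        have := mul_le_mul_of_nonneg_left hY2 (by positivity : (0 : ℝ) ≤ 4 * ((b' + 226 * (8 * (d + 1) * (d + 4)) ^ 2 * b' ^ 2) * (((L : ℝ) ^ k)⁻¹) ^ 2))
        have := mul_le_mul_of_nonneg_left hY1 (by positivity : (0 : ℝ) ≤ 4 * ((b' + 226 * (8 * (d + 1) * (d + 4)) ^ 2 * b' ^ 2) * (((L : ℝ) ^ k)⁻¹) ^ 2))
        nlinarith
      exact h4.trans (mul_le_mul_of_nonneg_left hpow3 (by positivity))
    have hS₂' := mul_le_mul_of_nonneg_right hS₂ (Real.rpow_nonneg hη.le ((2 : ℝ) + β))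
    nlinarith [h2, h3, hS₂']
  · -- the Laplacian member (§1)
    refine (norm_covLapDir_AdInv_le hWu ha hWsm hη A x κ).trans ?_
    have hs0 : 0 ≤ s := (norm_nonneg _).trans (hs x κ)
    have hsum : ∑ μ : Fin d, (‖iEta (((L : ℝ) ^ k)⁻¹) A (x + e μ) κ‖ + ‖iEta (((L : ℝ) ^ k)⁻¹) A (x - e μ) κ‖) ≤
        ∑ _μ : Fin d, 2 * ((((L : ℝ) ^ k)⁻¹) * s) :=
      Finset.sum_le_sum fun μ _ => by
        have h1 := norm_iEta_le hη.le hs (x + e μ) κ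
        have h2 := norm_iEta_le hη.le hs (x - e μ) κ
        linarith
    rw [Finset.sum_const, Finset.card_univ, Fintype.card_fin, nsmul_eq_mul] at hsum
    rw [← hηk, ha']
    have hl := hlap x κ
    have hη3 : 0 ≤ (((L : ℝ) ^ k)⁻¹) ^ 3 := by positivity
    have e3 : (ℓ + 4 * d * (b' + 226 * (8 * (d + 1) * (d + 4)) ^ 2 * b' ^ 2) * s) * (((L : ℝ) ^ k)⁻¹) ^ 3 =
        (((L : ℝ) ^ k)⁻¹) ^ 3 * ℓ + 2 * ((b' + 226 * (8 * (d + 1) * (d + 4)) ^ 2 * b' ^ 2) * (((L : ℝ) ^ k)⁻¹) ^ 2) * ((d : ℝ) * (2 * ((((L : ℝ) ^ k)⁻¹) * s))) := by ring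
    refine le_trans ?_ (mul_le_mul_of_nonneg_right hS₃ hη3)
    rw [e3]
    exact add_le_add (mul_le_mul_of_nonneg_left hl hη3) (mul_le_mul_of_nonneg_left hsum (by positivity))

end

end Summit.QuantumFields.YangMills.BalabanUVNodes.N16
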